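import Summits.Parity.GeneralizedHardyLittlewood.Theorems.LeeYangFibresRelativeDimOneDefs
import Summits.Parity.GeneralizedHardyLittlewood.Theorems.LeeYangFibresCellParityLawSingularRatio
import Literature.NumberTheory.Sieve.LinearEquationsInPrimesSingularSeries
import Literature.NumberTheory.Sieve.GallagherSingularSeries
import HarnessLib

/-!
# Route `LeeYangFibres`, crux `RelativeDimOne` (stmt-Parity-14113), line `SketchIdeator1` =
`translate-amplification`: the registered stub `stub_singularTail` (B2b, uniform tails of `𝔖` for `d = 1`)

We prove `SingularTail` (vocabulary `LeeYangFibresRelativeDimOneDefs`): for all `T, L`, `δ > 0` there is `N₀(T, L, δ)`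
with `|𝔖(Φ) − ∏_{p ≤ y} β_p(Φ)| ≤ δ ∏_{p ≤ y} β_p(Φ)`, `y = truncLevel N = ⌊log N/4⌋`, for all `N ≥ N₀` and all
NON-DEGENERATE systems `Φ` of `T` one-dimensional forms `φ_i(n) = a_i n + b_i` with `‖Φ‖_N ≤ L`. Such systems have
infinite complexity, so the tree's uniform Lemma 1.3 (`abs_localFactor_sub_one_le_of_coeff_bound`) does not apply (the
`b_i` are of size `N`); instead (Green–Tao 2010, proof of Lemma 1.3, with Gallagher's bookkeeping of exceptional primes):

* for `p ∤ a_i` every form has ONE root mod `p`, so `p − T ≤ g_p ≤ p` (first Bonferroni inequality) and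
  `1 − T/p ≤ β_p = p⁻¹ (p/(p−1))^T g_p ≤ (p/(p−1))^T ≤ exp(2T/p)`, whence `|β_p − 1| ≤ 4T/p` for `p ≥ 2T`;
* if also `p ∤ D_{ik} = a_i b_k − a_k b_i` (`i ≠ k`; "generic" `p`), no two forms share a root mod `p` and the arithmetic of
  Lemma 1.3 (`localFactor_estimate`, no pair terms) gives `|β_p − 1| ≤ T²/p²`;
* non-generic primes `> y` divide some non-zero `|D_{ik}| ≤ 2L²N`: at most `T² log(2L²N)/log y ≤ 16 T² y/log y` of them;
* so `∑_{y < p ≤ x} |β_p − 1| ≤ T²/y + 64 T³/log y =: σ ≤ δ/2`, `|∏_{y<p≤x} β_p − 1| ≤ e^σ − 1 ≤ 2σ ≤ δ` for `N ≥ N₀`;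
  multiply by `∏_{p ≤ y} β_p ≥ 0` and let `x → ∞` (Lemma 1.3, `tendsto_singularProductPartial_holds`).

References: B. Green, T. Tao, Ann. of Math. 171 (2010), Lemma 1.3, (1.6) [GreenTao2010]; P. X. Gallagher,
Mathematika 23 (1976), §2, eq. (7) [Gallagher1976].
-/

noncomputable section

open scoped BigOperators Topology
open Finset Filter Literature.NumberTheory.Sieve
open Summit.Parity.GeneralizedHardyLittlewood.Cruxes.CellParityLaw.SectionAnnihilator

namespace Summit.Parity.GeneralizedHardyLittlewood.Cruxes.RelativeDimOne.TranslateAmplification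

namespace SingularTailProof

variable {T : ℕ}

/-! ## Local factors of one-dimensional systems at a prime -/

/-- Non-degeneracy makes every coefficient `a_i` non-zero (`φ_i` is non-constant). [cite: GreenTao2010, Def. 1.1] -/
theorem coeff_ne_zero {Φ : Fin T → AffLinForm 1} (hΦ : IsNondegenerateSystem Φ) (i : Fin T) : (Φ i).coeff 0 ≠ 0 :=
  fun h0 => hΦ.1 i (funext fun j => by rw [Fin.fin_one_eq_zero j]; exact h0)

/-- Non-degeneracy makes every cross-discriminant `D_{ik} = a_i b_k − a_k b_i` (`i ≠ k`) non-zero (else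
`a_k φ_i = a_i φ_k` identically, forcing `a_i = 0`). [cite: GreenTao2010, Def. 1.1] -/
theorem crossDisc_ne_zero {Φ : Fin T → AffLinForm 1} (hΦ : IsNondegenerateSystem Φ) {i k : Fin T} (hik : i ≠ k) :
    (Φ i).coeff 0 * (Φ k).const - (Φ k).coeff 0 * (Φ i).const ≠ 0 := by
  intro h
  refine coeff_ne_zero hΦ i (hΦ.2 i k hik ((Φ k).coeff 0) ((Φ i).coeff 0) fun n => ?_).2
  simp only [AffLinForm.eval, Fin.sum_univ_one]
  linear_combination (-1 : ℤ) * h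

/-- `|D_{ik}| ≤ 2 L² N` from `|a_i| ≤ L`, `|b_i| ≤ L N` (`‖Φ‖_N ≤ L`, `N ≥ 1`). [folklore] -/
theorem natAbs_crossDisc_le {Φ : Fin T → AffLinForm 1} {N L : ℕ} (hN : 0 < N) (hL : affLinSize Φ N ≤ L)
    (i k : Fin T) : ((Φ i).coeff 0 * (Φ k).const - (Φ k).coeff 0 * (Φ i).const).natAbs ≤ 2 * L ^ 2 * N := by
  have ha : ∀ i, ((Φ i).coeff 0).natAbs ≤ L := fun i => natAbs_coeff_le_of_affLinSize_le hL i 0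
  have hb : ∀ i, ((Φ i).const).natAbs ≤ L * N := fun i => SingularRatio.natAbs_const_le_of_affLinSize_le hN hL i
  calc ((Φ i).coeff 0 * (Φ k).const - (Φ k).coeff 0 * (Φ i).const).natAbs
      ≤ ((Φ i).coeff 0 * (Φ k).const).natAbs + ((Φ k).coeff 0 * (Φ i).const).natAbs := Int.natAbs_sub_le _ _
    _ = ((Φ i).coeff 0).natAbs * ((Φ k).const).natAbs + ((Φ k).coeff 0).natAbs * ((Φ i).const).natAbs := by
        rw [Int.natAbs_mul, Int.natAbs_mul]
    _ ≤ L * (L * N) + L * (L * N) := add_le_add (Nat.mul_le_mul (ha _) (hb _)) (Nat.mul_le_mul (ha _) (hb _))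
    _ = 2 * L ^ 2 * N := by ring

/-- In dimension one a form with `a ≢ 0 (mod p)` vanishes on exactly ONE residue class: `#{v : φ_i(v) ≡ 0} · p = p`.
[cite: GreenTao2010, proof of Lemma 1.3] -/
theorem card_modZero_mul_one {p : ℕ} [Fact p.Prime] (Φ : Fin T → AffLinForm 1)
    (hA : ∀ i, (((Φ i).coeff 0 : ℤ) : ZMod p) ≠ 0) (i : Fin T) :
    #{v : Fin 1 → ZMod p | (Φ i).modEval p v = 0} * p = p ^ 1 :=
  card_modZero_mul (Φ i) fun hz => hA i (congr_fun hz 0)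

/-- GENERIC PRIMES: if `p ∤ a_i` for all `i`, `p ∤ D_{ik}` for all `i ≠ k` and `p ≥ 2T`, then `|β_p − 1| ≤ T²/p²` —
the arithmetic of Lemma 1.3 with `T` single roots and no common roots (`a_i φ_k − a_k φ_i ≡ D_{ik} ≢ 0`).
[cite: GreenTao2010, Lemma 1.3] -/
theorem abs_localFactor_sub_one_le_of_generic (Φ : Fin T → AffLinForm 1) {p : ℕ} (hp : p.Prime)
    (hA : ∀ i, (((Φ i).coeff 0 : ℤ) : ZMod p) ≠ 0)
    (hD : ∀ i k, i ≠ k → (((Φ i).coeff 0 * (Φ k).const - (Φ k).coeff 0 * (Φ i).const : ℤ) : ZMod p) ≠ 0)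
    (hpT : 2 * T ≤ p) : |localFactor Φ p - 1| ≤ (T : ℝ) ^ 2 / (p : ℝ) ^ 2 := by
  haveI := Fact.mk hp
  have h1 := card_modZero_mul_one Φ hA
  have h2 : ∀ ik ∈ (univ : Finset (Fin T)).offDiag,
      #{v : Fin 1 → ZMod p | (Φ ik.1).modEval p v = 0 ∧ (Φ ik.2).modEval p v = 0} * p ^ 2 ≤ p ^ 1 := by
    intro ik hik
    rw [filter_modZero_pair_eq_empty (Φ ik.1) (Φ ik.2) ((Φ ik.1).coeff 0) ((Φ ik.2).coeff 0)
      (fun j => by rw [Fin.fin_one_eq_zero j, mul_comm]) (hD ik.1 ik.2 (Finset.mem_offDiag.mp hik).2.2),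
      Finset.card_empty, zero_mul]
    exact Nat.zero_le _
  have hAp : (∑ i, #{v : Fin 1 → ZMod p | (Φ i).modEval p v = 0}) * p = T * p ^ 1 := by
    rw [Finset.sum_mul, Finset.sum_congr rfl fun i _ => h1 i, Finset.sum_const, Finset.card_univ, Fintype.card_fin,
      smul_eq_mul]
  have hBp : (∑ ik ∈ (univ : Finset (Fin T)).offDiag,
      #{v : Fin 1 → ZMod p | (Φ ik.1).modEval p v = 0 ∧ (Φ ik.2).modEval p v = 0}) * p ^ 2 ≤ (T * T - T) * p ^ 1 := by
    rw [Finset.sum_mul]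
    calc _ ≤ ∑ ik ∈ (univ : Finset (Fin T)).offDiag, p ^ 1 := Finset.sum_le_sum fun ik hik => h2 ik hik
      _ = _ := by rw [Finset.sum_const, smul_eq_mul, Finset.offDiag_card, Finset.card_univ, Fintype.card_fin]
  have hG : goodCount Φ p + _ = Fintype.card (Fin 1 → ZMod p) :=
    card_filter_forall_not_add (fun i v => (Φ i).modEval p v = 0)
  rw [card_zmod_pow p 1] at hG
  have hb1 := bonferroni_one (fun i v => (Φ i).modEval p v = 0)
  have hb2 := bonferroni_two (fun i v => (Φ i).modEval p v = 0)
  rw [localFactor_prime]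
  exact localFactor_estimate hp.two_le hpT hAp hBp (by omega) (by omega)

/-- ALL PRIMES `p ∤ a_i`: `1 − T/p ≤ β_p` (at most `T` residues are roots of some form, so `g_p ≥ p − T`, and
`(p/(p−1))^T ≥ 1`). [cite: GreenTao2010, proof of Lemma 1.3] -/
theorem one_sub_div_le_localFactor (Φ : Fin T → AffLinForm 1) {p : ℕ} (hp : p.Prime)
    (hA : ∀ i, (((Φ i).coeff 0 : ℤ) : ZMod p) ≠ 0) : 1 - (T : ℝ) / p ≤ localFactor Φ p := by
  haveI := Fact.mk hp
  have h1 := card_modZero_mul_one Φ hA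
  have hAp : (∑ i, #{v : Fin 1 → ZMod p | (Φ i).modEval p v = 0}) * p = T * p := by
    rw [Finset.sum_mul, Finset.sum_congr rfl fun i _ => h1 i, Finset.sum_const, Finset.card_univ, Fintype.card_fin,
      smul_eq_mul, pow_one]
  have hsum : ∑ i, #{v : Fin 1 → ZMod p | (Φ i).modEval p v = 0} = T := Nat.eq_of_mul_eq_mul_right hp.pos hAp
  have hG : goodCount Φ p + _ = Fintype.card (Fin 1 → ZMod p) :=
    card_filter_forall_not_add (fun i v => (Φ i).modEval p v = 0)
  rw [card_zmod_pow p 1, pow_one] at hG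
  have hb1 := bonferroni_one (fun i v => (Φ i).modEval p v = 0)
  have hg : p ≤ goodCount Φ p + T := by omega
  have hp2 : (2 : ℝ) ≤ p := by exact_mod_cast hp.two_le
  have hr1 : (1 : ℝ) ≤ (p : ℝ) / (p - 1) := by
    rw [le_div_iff₀ (by linarith)]
    linarith
  have hg' : (p : ℝ) - T ≤ goodCount Φ p := by
    have : ((p : ℕ) : ℝ) ≤ ((goodCount Φ p + T : ℕ) : ℝ) := by exact_mod_cast hg
    push_cast at this
    linarith
  rw [localFactor_prime, pow_one]
  calc 1 - (T : ℝ) / p = (p : ℝ)⁻¹ * ((p : ℝ) - T) := by field_simp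
    _ ≤ (p : ℝ)⁻¹ * (goodCount Φ p : ℝ) := mul_le_mul_of_nonneg_left hg' (by positivity)
    _ ≤ (p : ℝ)⁻¹ * (((p : ℝ) / (p - 1)) ^ T * goodCount Φ p) := by
        refine mul_le_mul_of_nonneg_left ?_ (by positivity)
        calc (goodCount Φ p : ℝ) = 1 * goodCount Φ p := (one_mul _).symm
          _ ≤ ((p : ℝ) / (p - 1)) ^ T * goodCount Φ p := mul_le_mul_of_nonneg_right (one_le_pow₀ hr1) (Nat.cast_nonneg _)

/-- ALL PRIMES `p ∤ a_i`, `p ≥ 2T`: `|β_p − 1| ≤ 4T/p`, from `1 − T/p ≤ β_p ≤ (p/(p−1))^T = (1 − 1/p)^{−T} ≤ exp(2T/p)`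
(`localFactor_prime_le`, `Gallagher.inv_one_sub_bounds`) and `exp(u) − 1 ≤ 2u` for `0 ≤ u ≤ 1`.
[cite: GreenTao2010, proof of Lemma 1.3] -/
theorem abs_localFactor_sub_one_le_of_coeff (Φ : Fin T → AffLinForm 1) {p : ℕ} (hp : p.Prime)
    (hA : ∀ i, (((Φ i).coeff 0 : ℤ) : ZMod p) ≠ 0) (hpT : 2 * T ≤ p) : |localFactor Φ p - 1| ≤ 4 * T / p := by
  have hp2 : (2 : ℝ) ≤ p := by exact_mod_cast hp.two_le
  have hp0 : (0 : ℝ) < p := by linarith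
  have hl := one_sub_div_le_localFactor Φ hp hA
  -- upper bound `β_p ≤ exp(2T/p)`
  have heq : (p : ℝ) / (p - 1) = (1 - 1 / (p : ℝ))⁻¹ := by field_simp
  obtain ⟨-, hu⟩ := Gallagher.inv_one_sub_bounds hp2
  have hu' : localFactor Φ p ≤ Real.exp (2 * T / p) :=
    calc localFactor Φ p ≤ ((p : ℝ) / (p - 1)) ^ T := localFactor_prime_le Φ hp
      _ ≤ Real.exp (2 / p) ^ T := pow_le_pow_left₀ (div_nonneg hp0.le (by linarith)) (by rw [heq]; exact hu) T
      _ = Real.exp (2 * T / p) := by rw [← Real.exp_nat_mul]; ring_nf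
  have hx1 : 2 * (T : ℝ) / p ≤ 1 := by rw [div_le_one hp0]; exact_mod_cast hpT
  -- with `u = T/p`: `1 - u ≤ β_p ≤ exp(2u) ≤ 1 + 4u`
  have e2 : 2 * (T : ℝ) / p = 2 * ((T : ℝ) / p) := by ring
  have e4 : 4 * (T : ℝ) / p = 4 * ((T : ℝ) / p) := by ring
  rw [e2] at hu' hx1
  rw [e4, abs_le]
  have hx0 : (0 : ℝ) ≤ 2 * ((T : ℝ) / p) := by positivity
  have he : Real.exp (2 * ((T : ℝ) / p)) - 1 ≤ 2 * (2 * ((T : ℝ) / p)) := by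
    have := Real.abs_exp_sub_one_le (x := 2 * ((T : ℝ) / p)) (by rwa [abs_of_nonneg hx0])
    rw [abs_of_nonneg hx0] at this
    exact (le_abs_self _).trans this
  constructor <;> linarith

/-! ## The non-generic primes are few -/

/-- Union bound: among primes `> y ≥ 2`, those dividing `D i k` for some `i ≠ k`, where `0 < D i k ≤ H`, number at most
`T² · log H / log y` (each `D i k` has `≤ log H / log y` prime factors `> y`: `Gallagher.card_primes_dvd_le`).
[cite: Gallagher1976, Section 2 p. 6] -/
theorem card_filter_not_generic_le (D : Fin T → Fin T → ℕ) {H y : ℕ} (hy : 2 ≤ y)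
    (hD : ∀ i k, i ≠ k → 0 < D i k ∧ D i k ≤ H) (PR : Finset ℕ) (hPR : ∀ p ∈ PR, p.Prime ∧ y < p) :
    (#(PR.filter fun p => ¬ ∀ i k, i ≠ k → ¬ p ∣ D i k) : ℝ) ≤ (T : ℝ) ^ 2 * (Real.log H / Real.log y) := by
  classical
  set pairs := (univ : Finset (Fin T × Fin T)).filter fun ik => ik.1 ≠ ik.2 with hpairs
  have hcover : (PR.filter fun p => ¬ ∀ i k, i ≠ k → ¬ p ∣ D i k) ⊆
      pairs.biUnion fun ik => PR.filter fun p => p ∣ D ik.1 ik.2 := by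
    intro p hp
    obtain ⟨hp1, hp2⟩ := Finset.mem_filter.mp hp
    push Not at hp2
    obtain ⟨i, k, hik, hdvd⟩ := hp2
    exact Finset.mem_biUnion.mpr ⟨(i, k), by simp [hpairs, hik], Finset.mem_filter.2 ⟨hp1, hdvd⟩⟩
  have hlogy : 0 < Real.log y := Real.log_pos (by exact_mod_cast (by omega : 1 < y))
  have heach : ∀ ik ∈ pairs, (#(PR.filter fun p => p ∣ D ik.1 ik.2) : ℝ) ≤ Real.log H / Real.log y := by
    rintro ⟨i, k⟩ hik
    simp only [hpairs, Finset.mem_filter, Finset.mem_univ, true_and] at hik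
    refine Gallagher.card_primes_dvd_le (hD i k hik).1 (hD i k hik).2 hy _ fun p hp => ?_
    rw [Finset.mem_filter] at hp
    exact ⟨(hPR p hp.1).1, (hPR p hp.1).2, hp.2⟩
  calc (#(PR.filter fun p => ¬ ∀ i k, i ≠ k → ¬ p ∣ D i k) : ℝ)
      ≤ #(pairs.biUnion fun ik => PR.filter fun p => p ∣ D ik.1 ik.2) := by exact_mod_cast Finset.card_le_card hcover
    _ ≤ ∑ ik ∈ pairs, (#(PR.filter fun p => p ∣ D ik.1 ik.2) : ℝ) := by exact_mod_cast Finset.card_biUnion_le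
    _ ≤ ∑ ik ∈ pairs, Real.log H / Real.log y := Finset.sum_le_sum heach
    _ = #pairs * (Real.log H / Real.log y) := by rw [Finset.sum_const, nsmul_eq_mul]
    _ ≤ (T : ℝ) ^ 2 * (Real.log H / Real.log y) := by
        refine mul_le_mul_of_nonneg_right ?_ (div_nonneg (Real.log_natCast_nonneg H) hlogy.le)
        have : #pairs ≤ T ^ 2 :=
          calc #pairs ≤ #(univ : Finset (Fin T × Fin T)) := Finset.card_filter_le _ _
            _ = T ^ 2 := by simp [sq]
        exact_mod_cast this

/-! ## The tail sum `∑_{y < p ≤ x} |β_p − 1|` -/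

/-- For a non-degenerate one-dimensional system with `‖Φ‖_N ≤ L` and `y ≥ max(2, L, 2T)`, for every `x`:
`∑_{y < p ≤ x} |β_p − 1| ≤ T²/y + (4T/y) · T² log(2L²N)/log y` (generic primes: `∑_{p > y} T²/p² ≤ T²/y`; the others:
`4T/y` each, at most `T² log(2L²N)/log y` of them). [cite: GreenTao2010, Lemma 1.3] -/
theorem sum_abs_localFactor_sub_one_le (Φ : Fin T → AffLinForm 1) (hΦ : IsNondegenerateSystem Φ) {N L y : ℕ}
    (hN : 0 < N) (hL : affLinSize Φ N ≤ L) (hy2 : 2 ≤ y) (hyL : L ≤ y) (hyT : 2 * T ≤ y) (x : ℕ) :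
    ∑ p ∈ Nat.primesLE x \ Nat.primesLE y, |localFactor Φ p - 1| ≤
      (T : ℝ) ^ 2 / y + 4 * T / y * ((T : ℝ) ^ 2 * (Real.log ((2 * L ^ 2 * N : ℕ) : ℝ) / Real.log y)) := by
  classical
  set PR := Nat.primesLE x \ Nat.primesLE y with hPR
  set D : Fin T → Fin T → ℕ := fun i k => ((Φ i).coeff 0 * (Φ k).const - (Φ k).coeff 0 * (Φ i).const).natAbs
    with hDdef
  have hmem : ∀ p ∈ PR, p.Prime ∧ y < p ∧ p ≤ x := by
    intro p hp
    obtain ⟨hp1, hp2⟩ := Finset.mem_sdiff.mp hp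
    rw [Nat.mem_primesLE] at hp1 hp2
    exact ⟨hp1.2, by by_contra hh; exact hp2 ⟨by omega, hp1.2⟩, hp1.1⟩
  have hy0 : (0 : ℝ) < y := by exact_mod_cast (by omega : 0 < y)
  have hA : ∀ p ∈ PR, ∀ i, (((Φ i).coeff 0 : ℤ) : ZMod p) ≠ 0 := fun p hp i =>
    intCast_zmod_ne_zero_of_natAbs_lt (coeff_ne_zero hΦ i)
      (lt_of_le_of_lt ((natAbs_coeff_le_of_affLinSize_le hL i 0).trans hyL) (hmem p hp).2.1)
  rw [← Finset.sum_filter_add_sum_filter_not PR (fun p => ∀ i k, i ≠ k → ¬ p ∣ D i k)]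
  refine add_le_add ?_ ?_
  · -- generic primes
    calc ∑ p ∈ PR.filter (fun p => ∀ i k, i ≠ k → ¬ p ∣ D i k), |localFactor Φ p - 1|
        ≤ ∑ p ∈ PR.filter (fun p => ∀ i k, i ≠ k → ¬ p ∣ D i k), (T : ℝ) ^ 2 / (p : ℝ) ^ 2 := by
          refine Finset.sum_le_sum fun p hp => ?_
          obtain ⟨hp1, hp2⟩ := Finset.mem_filter.mp hp
          refine abs_localFactor_sub_one_le_of_generic Φ (hmem p hp1).1 (hA p hp1) (fun i k hik hz => hp2 i k hik ?_)
            (by linarith [(hmem p hp1).2.1])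
          exact Int.natCast_dvd.mp ((ZMod.intCast_zmod_eq_zero_iff_dvd _ p).mp hz)
      _ ≤ ∑ p ∈ PR, (T : ℝ) ^ 2 / (p : ℝ) ^ 2 :=
          Finset.sum_le_sum_of_subset_of_nonneg (Finset.filter_subset _ _) (fun p _ _ => by positivity)
      _ ≤ ∑ n ∈ Finset.Ioc y x, (T : ℝ) ^ 2 / (n : ℝ) ^ 2 := by
          refine Finset.sum_le_sum_of_subset_of_nonneg (fun p hp => ?_) (fun n _ _ => by positivity)
          exact Finset.mem_Ioc.mpr ⟨(hmem p hp).2.1, (hmem p hp).2.2⟩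
      _ = (T : ℝ) ^ 2 * ∑ n ∈ Finset.Ioc y x, ((n : ℝ) ^ 2)⁻¹ := by
          rw [Finset.mul_sum]
          exact Finset.sum_congr rfl fun n _ => by rw [div_eq_mul_inv]
      _ ≤ (T : ℝ) ^ 2 * (y : ℝ)⁻¹ := by gcongr; exact sum_Ioc_inv_sq_le (by omega) x
      _ = (T : ℝ) ^ 2 / y := by rw [div_eq_mul_inv]
  · -- the non-generic primes
    calc ∑ p ∈ PR.filter (fun p => ¬ ∀ i k, i ≠ k → ¬ p ∣ D i k), |localFactor Φ p - 1|
        ≤ ∑ p ∈ PR.filter (fun p => ¬ ∀ i k, i ≠ k → ¬ p ∣ D i k), 4 * (T : ℝ) / y := by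
          refine Finset.sum_le_sum fun p hp => ?_
          obtain ⟨hp1, -⟩ := Finset.mem_filter.mp hp
          obtain ⟨hpp, hyp, -⟩ := hmem p hp1
          refine (abs_localFactor_sub_one_le_of_coeff Φ hpp (hA p hp1) (by omega)).trans ?_
          exact div_le_div_of_nonneg_left (by positivity) hy0 (by exact_mod_cast hyp.le)
      _ = #(PR.filter (fun p => ¬ ∀ i k, i ≠ k → ¬ p ∣ D i k)) * (4 * (T : ℝ) / y) := by
          rw [Finset.sum_const, nsmul_eq_mul]
      _ ≤ (T : ℝ) ^ 2 * (Real.log ((2 * L ^ 2 * N : ℕ) : ℝ) / Real.log y) * (4 * (T : ℝ) / y) := by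
          refine mul_le_mul_of_nonneg_right ?_ (by positivity)
          exact card_filter_not_generic_le D hy2
            (fun i k hik => ⟨Int.natAbs_pos.mpr (crossDisc_ne_zero hΦ hik), natAbs_crossDisc_le hN hL i k⟩)
            PR (fun p hp => ⟨(hmem p hp).1, (hmem p hp).2.1⟩)
      _ = 4 * T / y * ((T : ℝ) ^ 2 * (Real.log ((2 * L ^ 2 * N : ℕ) : ℝ) / Real.log y)) := by ring

/-! ## The truncation level `y_N = ⌊log N / 4⌋` -/

/-- The threshold `N₀(T, L, η)`: for `N ≥ N₀`, `y = truncLevel N` satisfies `y ≥ max(2, L, 2T)` and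
`T²/y + (4T/y) · T² log(2L²N)/log y ≤ η` (as `log(2L²N) ≤ 2 log N ≤ 16 y`, the left side is `≤ T²/y + 64 T³/log y`).
[folklore] -/
theorem exists_threshold (T L : ℕ) {η : ℝ} (hη : 0 < η) : ∃ N₀ : ℕ, ∀ N : ℕ, N₀ ≤ N →
    0 < N ∧ 2 ≤ truncLevel N ∧ L ≤ truncLevel N ∧ 2 * T ≤ truncLevel N ∧
      (T : ℝ) ^ 2 / (truncLevel N : ℕ) + 4 * T / (truncLevel N : ℕ) * ((T : ℝ) ^ 2 *
        (Real.log ((2 * L ^ 2 * N : ℕ) : ℝ) / Real.log (truncLevel N : ℕ))) ≤ η := by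
  set Y₀ : ℕ := max (max 2 (max L (2 * T)))
    (max (2 * L ^ 2) (max ⌈2 * (T : ℝ) ^ 2 / η⌉₊ ⌈Real.exp (128 * (T : ℝ) ^ 3 / η)⌉₊)) with hY₀
  refine ⟨⌈Real.exp (4 * Y₀)⌉₊, fun N hN => ?_⟩
  have hN1 : Real.exp (4 * Y₀) ≤ N := (Nat.le_ceil _).trans (by exact_mod_cast hN)
  have hNr : (0 : ℝ) < N := (Real.exp_pos _).trans_le hN1
  have hlogN : 4 * (Y₀ : ℝ) ≤ Real.log N := (Real.le_log_iff_exp_le hNr).mpr hN1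
  have hy : Y₀ ≤ truncLevel N := by
    unfold truncLevel
    exact Nat.le_floor (by linarith)
  have hylt : Real.log N / 4 < (truncLevel N : ℝ) + 1 := Nat.lt_floor_add_one _
  set y := truncLevel N with hydef
  have hy2 : 2 ≤ y := le_trans (by omega) hy
  have hYa : ⌈2 * (T : ℝ) ^ 2 / η⌉₊ ≤ Y₀ := by omega
  have hYb : ⌈Real.exp (128 * (T : ℝ) ^ 3 / η)⌉₊ ≤ Y₀ := by omega
  refine ⟨by exact_mod_cast hNr, hy2, le_trans (by omega) hy, le_trans (by omega) hy, ?_⟩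
  have hy0 : (0 : ℝ) < y := by exact_mod_cast (by omega : 0 < y)
  have hlogy : 0 < Real.log y := Real.log_pos (by exact_mod_cast (by omega : 1 < y))
  have hy2r : (2 : ℝ) ≤ y := by exact_mod_cast hy2
  -- `log (2 L² N) ≤ 16 y`
  have hH : Real.log ((2 * L ^ 2 * N : ℕ) : ℝ) ≤ 16 * y := by
    have hYN : (Y₀ : ℝ) ≤ N := by linarith [Real.log_le_sub_one_of_pos hNr, (Nat.cast_nonneg Y₀ : (0 : ℝ) ≤ Y₀)]
    have h1 : 2 * L ^ 2 * N ≤ N * N := Nat.mul_le_mul_right N (le_trans (by omega) (by exact_mod_cast hYN : Y₀ ≤ N))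
    have h2 : Real.log ((2 * L ^ 2 * N : ℕ) : ℝ) ≤ Real.log ((N * N : ℕ) : ℝ) := by
      rcases Nat.eq_zero_or_pos (2 * L ^ 2 * N) with h0 | hpos
      · rw [h0, Nat.cast_zero, Real.log_zero]
        exact Real.log_natCast_nonneg _
      · exact Real.log_le_log (by exact_mod_cast hpos) (by exact_mod_cast h1)
    have h3 : Real.log ((N * N : ℕ) : ℝ) = 2 * Real.log N := by
      push_cast
      rw [Real.log_mul hNr.ne' hNr.ne']
      ring
    linarith
  -- the two halves
  have hA : (T : ℝ) ^ 2 / y ≤ η / 2 := by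
    have h1 : 2 * (T : ℝ) ^ 2 / η ≤ ⌈2 * (T : ℝ) ^ 2 / η⌉₊ := Nat.le_ceil _
    have h2 : (⌈2 * (T : ℝ) ^ 2 / η⌉₊ : ℝ) ≤ y := by exact_mod_cast hYa.trans hy
    rw [div_le_iff₀ hy0]
    rw [div_le_iff₀ hη] at h1
    nlinarith [mul_le_mul_of_nonneg_left h2 hη.le]
  have hB : 4 * (T : ℝ) / y * ((T : ℝ) ^ 2 * (Real.log ((2 * L ^ 2 * N : ℕ) : ℝ) / Real.log y)) ≤ η / 2 := by
    have hT0 : (0 : ℝ) ≤ T := Nat.cast_nonneg _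
    calc 4 * (T : ℝ) / y * ((T : ℝ) ^ 2 * (Real.log ((2 * L ^ 2 * N : ℕ) : ℝ) / Real.log y))
        = 4 * (T : ℝ) ^ 3 * Real.log ((2 * L ^ 2 * N : ℕ) : ℝ) / (y * Real.log y) := by field_simp
      _ ≤ 4 * (T : ℝ) ^ 3 * (16 * y) / (y * Real.log y) := by gcongr
      _ = 64 * (T : ℝ) ^ 3 / Real.log y := by field_simp; ring
      _ ≤ η / 2 := by
          rw [div_le_iff₀ hlogy]
          have h1 : Real.exp (128 * (T : ℝ) ^ 3 / η) ≤ y := by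
            have h2 : (⌈Real.exp (128 * (T : ℝ) ^ 3 / η)⌉₊ : ℝ) ≤ y := by exact_mod_cast hYb.trans hy
            linarith [Nat.le_ceil (Real.exp (128 * (T : ℝ) ^ 3 / η))]
          have h3 : 128 * (T : ℝ) ^ 3 / η ≤ Real.log y := (Real.le_log_iff_exp_le hy0).mpr h1
          rw [div_le_iff₀ hη] at h3
          nlinarith
  linarith

end SingularTailProof

open SingularTailProof in
/-- **`stub_singularTail`** (registered stub B2b of the line `SketchIdeator1`): UNIFORM TAILS OF THE SINGULAR PRODUCT in
dimension one — for every `T, L` and `δ > 0` there is `N₀` with `|𝔖(Φ) − ∏_{p ≤ y_N} β_p(Φ)| ≤ δ ∏_{p ≤ y_N} β_p(Φ)`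
(`y_N = ⌊log N/4⌋`) for all `N ≥ N₀` and all non-degenerate `Φ : Fin T → AffLinForm 1` with `‖Φ‖_N ≤ L`: for `x ≥ y`,
`|∏_{y < p ≤ x} β_p − 1| ≤ exp(∑ |β_p − 1|) − 1 ≤ δ` (`sum_abs_localFactor_sub_one_le`, `exists_threshold`), then
`x → ∞` by Lemma 1.3 (`tendsto_singularProductPartial_holds`). [cite: GreenTao2010, Lemma 1.3] -/
theorem stub_singularTail : SingularTail := by
  intro T L δ hδ
  have hη : 0 < min δ 1 / 2 := by positivity
  obtain ⟨N₀, hN₀⟩ := exists_threshold T L hη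
  refine ⟨N₀, fun N hN Φ hΦ hL => ?_⟩
  obtain ⟨hNpos, hy2, hyL, hyT, hσ⟩ := hN₀ N hN
  set y := truncLevel N with hydef
  have hδ1 : min δ 1 ≤ δ := min_le_left _ _
  have hδ2 : min δ 1 ≤ 1 := min_le_right _ _
  have hP0 := SingularRatio.singularProductPartial_nonneg Φ y
  -- the tail estimate for every `x ≥ y`
  have htail : ∀ x : ℕ, y ≤ x →
      |singularProductPartial Φ x - singularProductPartial Φ y| ≤ δ * singularProductPartial Φ y := by
    intro x hyx
    set Q := ∏ p ∈ Nat.primesLE x \ Nat.primesLE y, localFactor Φ p with hQ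
    have hsplit : singularProductPartial Φ x = singularProductPartial Φ y * Q := by
      unfold singularProductPartial
      rw [hQ, mul_comm, Finset.prod_sdiff (Nat.primesLE_mono hyx)]
    have hs : ∑ p ∈ Nat.primesLE x \ Nat.primesLE y, |localFactor Φ p - 1| ≤ min δ 1 / 2 :=
      (sum_abs_localFactor_sub_one_le Φ hΦ hNpos hL hy2 hyL hyT x).trans hσ
    have h1 : |Q - 1| ≤ Real.exp (∑ p ∈ Nat.primesLE x \ Nat.primesLE y, |localFactor Φ p - 1|) - 1 := by
      have := Finset.norm_prod_one_add_sub_one_le (Nat.primesLE x \ Nat.primesLE y) (fun p => localFactor Φ p - 1)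
      simp only [add_sub_cancel, Real.norm_eq_abs] at this
      rw [hQ]
      exact this
    have h2 := Real.exp_le_exp.mpr hs
    have h3 : Real.exp (min δ 1 / 2) - 1 ≤ 2 * (min δ 1 / 2) := by
      have := Real.abs_exp_sub_one_le (x := min δ 1 / 2) (by rw [abs_of_nonneg hη.le]; linarith)
      rw [abs_of_nonneg hη.le] at this
      exact (le_abs_self _).trans this
    have hQ1 : |Q - 1| ≤ δ := by linarith
    calc |singularProductPartial Φ x - singularProductPartial Φ y| = |singularProductPartial Φ y| * |Q - 1| := by
          rw [hsplit, ← abs_mul]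
          ring_nf
      _ ≤ singularProductPartial Φ y * δ := by rw [abs_of_nonneg hP0]; exact mul_le_mul_of_nonneg_left hQ1 hP0
      _ = δ * singularProductPartial Φ y := mul_comm _ _
  -- pass to the limit `x → ∞` (Lemma 1.3 for the non-degenerate system `Φ`)
  have hlim : Tendsto (fun x => |singularProductPartial Φ x - singularProductPartial Φ y|) atTop
      (𝓝 |singularProduct Φ - singularProductPartial Φ y|) :=
    (continuous_abs.tendsto _).comp ((tendsto_singularProductPartial_holds 1 T Φ hΦ).sub tendsto_const_nhds)
  exact le_of_tendsto hlim (Filter.eventually_atTop.mpr ⟨y, htail⟩)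

end Summit.Parity.GeneralizedHardyLittlewood.Cruxes.RelativeDimOne.TranslateAmplification

end
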